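import Literature.NumberTheory.LFunctions.Bettin2017FirstMomentPrimeLevel
import Literature.NumberTheory.LFunctions.HeckeLambdaDivisorBoundWeightTwo
import HarnessLib

/-!
# Bettin 2017, Thm. 1.1 at prime level in the large-shift regime `m ≥ N^{12}` («otherwise the result
# is trivial»), from Deligne's bound; the named fact from Petersson's formula and Deligne's bound

Topic `Literature/NumberTheory/LFunctions` (cell landau-siegel / ls-inputs, input I2 =
`bettin2017_theorem11_primeLevel`, line `hecke_afe_petersson`, stub S6 `stub_largeShift`).

* `Bettin2017.largeShift_of_deligne_of_petersson` — the registered stub S6, GIVEN the tree's named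
  facts `Deligne1974_heckeT_eigenvalue_norm_le` (Deligne 1974, Thm. 8.2) and
  `KowalskiMichel2000.kowalskiMichel2000_peterssonFormula` (Petersson at prime level): with `B = 12`,
  for every `ε > 0` there are `C, N₀` with `‖Σ^h_f λ_f(m) L(½,f) − m^{-1/2}‖ ≤ C m^{1/2} N^{-1+ε}` for
  all primes `N ≥ N₀` and all `m ≥ N^{12}`. This is Bettin's «we assume m ≪ N^{100} (otherwise the
  result is trivial)» (p. 5): `|λ_f(m)| ≤ d(m) ≤ C' m^{1/4}` (Deligne, divisor bound),
  `|L(½,f)| ≤ |D_f(1/N)| + |D_f(1)| ≤ 2N²` (the exact two-sided formula at height `1/N` with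
  `|a_f(n)| ≤ d(n)√n ≤ n^{3/2}`), `Σ^h_f 1 = 1 − J_N(1,1) ≤ 1 + C₁` (Petersson + (23)); so the moment
  is `≤ 2(1+C₁)C' m^{1/4} N² ≤ 2(1+C₁)C' m^{1/2} N^{-1}` once `m^{1/4} ≥ N³`.
* `Bettin2017.bettin2017_theorem11_primeLevel_of_petersson_of_deligne` — **the named fact
  `bettin2017_theorem11_primeLevel` (Bettin 2017 Thm. 1.1, ν = 1, k = 2, χ = 1, α = 0, all m ≥ 1)
  follows from Petersson's formula at prime level and Deligne's bound**, everything else being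
  kernel theorems of the tree (`firstMoment_sub_le_of_petersson` for `m ≤ N^{12}`).

No definition, no named fact. «The programme SEARCHES and TYPES; no claim about Landau–Siegel
zeros, Theorems 1–2 of arXiv:2211.02515 or a repaired Margin232 until a kernel theorem says so.»
-/

noncomputable section

open scoped Real
open Complex CongruenceSubgroup
open Literature.NumberTheory.EllipticCurves.ModularForms

namespace Literature.NumberTheory.LFunctions.Bettin2017

variable {N : ℕ} [NeZero N]

/-! ### Bounds for the pieces -/

/-- `Σ_n n e^{-2πny} ≤ (πy)⁻¹((πy)⁻¹ + 1)` for `y > 0`. [folklore] -/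
private theorem tsum_nat_mul_exp_le' {y : ℝ} (hy : 0 < y) :
    Summable (fun n : ℕ ↦ (n : ℝ) * Real.exp (-(2 * π * n) * y)) ∧
      ∑' n : ℕ, (n : ℝ) * Real.exp (-(2 * π * n) * y) ≤ (π * y)⁻¹ * ((π * y)⁻¹ + 1) := by
  have hπy : 0 < π * y := by positivity
  set x := Real.exp (-(π * y)) with hx
  have hx0 : 0 < x := Real.exp_pos _
  have hx1 : x < 1 := by
    rw [hx, ← Real.exp_zero]; exact Real.exp_lt_exp.mpr (by linarith)
  have hterm : ∀ n : ℕ, (n : ℝ) * Real.exp (-(2 * π * n) * y) ≤ (π * y)⁻¹ * x ^ n := by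
    intro n
    have hsplit : Real.exp (-(2 * π * n) * y) = Real.exp (-(π * y * n)) * x ^ n := by
      rw [hx, ← Real.exp_nat_mul, ← Real.exp_add]; congr 1; ring
    have h1 : (π * y * n) * Real.exp (-(π * y * n)) ≤ 1 := by
      have h := Real.add_one_le_exp (π * y * n)
      have hprod : Real.exp (-(π * y * n)) * Real.exp (π * y * n) = 1 := by
        rw [← Real.exp_add]; simp
      nlinarith [Real.exp_pos (-(π * y * n))]
    rw [hsplit, ← mul_assoc]
    refine mul_le_mul_of_nonneg_right ?_ (pow_nonneg hx0.le n)
    rw [inv_eq_one_div, le_div_iff₀ hπy]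
    calc (n : ℝ) * Real.exp (-(π * y * n)) * (π * y)
        = (π * y * n) * Real.exp (-(π * y * n)) := by ring
      _ ≤ 1 := h1
  have hgeom := hasSum_geometric_of_lt_one hx0.le hx1
  have hdom : Summable (fun n : ℕ ↦ (π * y)⁻¹ * x ^ n) := hgeom.summable.mul_left _
  have hnonneg : ∀ n : ℕ, 0 ≤ (n : ℝ) * Real.exp (-(2 * π * n) * y) := fun n ↦ by positivity
  have hs : Summable (fun n : ℕ ↦ (n : ℝ) * Real.exp (-(2 * π * n) * y)) :=
    Summable.of_nonneg_of_le hnonneg hterm hdom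
  refine ⟨hs, (hs.tsum_le_tsum hterm hdom).trans ?_⟩
  rw [tsum_mul_left, hgeom.tsum_eq]
  have h1x : 0 < 1 - x := by linarith
  have hkey : (1 - x)⁻¹ ≤ (π * y)⁻¹ + 1 := by
    rw [inv_le_iff_one_le_mul₀ h1x]
    have h := Real.add_one_le_exp (π * y)
    have hprod : x * Real.exp (π * y) = 1 := by rw [hx, ← Real.exp_add]; simp
    have hx' : x * (1 + π * y) ≤ 1 := by nlinarith
    have heq : ((π * y)⁻¹ + 1) * (1 - x) = 1 + (1 - x * (1 + π * y)) * (π * y)⁻¹ := by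
      field_simp; ring
    rw [heq]
    have hnn : 0 ≤ (1 - x * (1 + π * y)) * (π * y)⁻¹ :=
      mul_nonneg (by linarith) (inv_pos.mpr hπy).le
    linarith
  exact mul_le_mul_of_nonneg_left hkey (inv_pos.mpr hπy).le

/-- **The damped series under Deligne's bound**: for a newform `f ∈ S_2(Γ₀(N))` and `y > 0`,
`‖D_f(y)‖ ≤ (πy)⁻¹((πy)⁻¹ + 1)` (`|a_f(n)| ≤ d(n)√n ≤ n^{3/2}`, so `|a_f(n)| e^{-2πny}/n ≤ n e^{-2πny}`).
[cite: Deligne1974, Thm. 8.2] -/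
theorem norm_dampedTwist_le_of_deligne (hD : Deligne1974_heckeT_eigenvalue_norm_le)
    {f : CuspForm (Gamma0 N) 2} (hf : IsNewform0 f) {y : ℝ} (hy : 0 < y) :
    ‖dampedTwist f (fun _ ↦ 1) y‖ ≤ (π * y)⁻¹ * ((π * y)⁻¹ + 1) := by
  obtain ⟨hs, hle⟩ := tsum_nat_mul_exp_le' hy
  have h1 := norm_dampedTwist_le f (w := fun _ ↦ (1 : ℂ)) (B := 1) (fun _ ↦ by simp) hy
  refine h1.trans (le_trans ?_ hle)
  have hterm : ∀ n : ℕ, ‖(1 : ℂ)‖ * ‖cuspCoeff f n‖ * (Real.exp (-(2 * Real.pi * n) * y) / n) ≤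
      (n : ℝ) * Real.exp (-(2 * π * n) * y) := by
    intro n
    rcases Nat.eq_zero_or_pos n with rfl | hn
    · simp
    have hn0 : (0 : ℝ) < n := by exact_mod_cast hn
    have ha := GL2Family.norm_cuspCoeff_le_card_divisors_mul_sqrt_of_deligne hD hf n
    have hd : (n.divisors.card : ℝ) ≤ n := by exact_mod_cast Nat.card_divisors_le_self n
    have hn1 : (1 : ℝ) ≤ n := by exact_mod_cast hn
    have hsq : Real.sqrt n ≤ n := by
      rw [Real.sqrt_le_left hn0.le]; nlinarith
    rw [norm_one, one_mul]
    calc ‖cuspCoeff f n‖ * (Real.exp (-(2 * Real.pi * n) * y) / n)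
        ≤ ((n : ℝ) * n) * (Real.exp (-(2 * Real.pi * n) * y) / n) := by
          refine mul_le_mul_of_nonneg_right (ha.trans ?_) (by positivity)
          exact mul_le_mul hd hsq (Real.sqrt_nonneg _) hn0.le
      _ = (n : ℝ) * Real.exp (-(2 * π * n) * y) := by field_simp
  have hnn : ∀ n : ℕ, 0 ≤ ‖(1 : ℂ)‖ * ‖cuspCoeff f n‖ * (Real.exp (-(2 * Real.pi * n) * y) / n) :=
    fun n ↦ by positivity
  exact (Summable.of_nonneg_of_le hnn hterm hs).tsum_le_tsum hterm hs

/-- **The central value under Deligne's bound**: `‖L(½,f)‖ ≤ 2N²` for a newform `f ∈ S_2(Γ₀(N))`,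
`N ≥ 2` (the exact two-sided formula at height `1/N`: `L = D_f(1/N) − ε_f D_f(1)`, `ε_f = ±1`).
[cite: Deligne1974, Thm. 8.2] -/
theorem norm_centralValue_le_of_deligne (hD : Deligne1974_heckeT_eigenvalue_norm_le)
    (hN : 2 ≤ N) {f : CuspForm (Gamma0 N) 2} (hf : IsNewform0 f) :
    ‖IwaniecSarnak.centralValue f‖ ≤ 2 * (N : ℝ) ^ 2 := by
  have hN0 : (0 : ℝ) < N := by exact_mod_cast (show 0 < N by omega)
  have hN2 : (2 : ℝ) ≤ N := by exact_mod_cast hN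
  have hy : (0 : ℝ) < 1 / N := by positivity
  have hform := centralValue_eq_dampedTwist_sub f hf hy
  have hyN : 1 / ((N : ℝ) * (1 / N)) = 1 := by field_simp
  rw [hyN] at hform
  rw [hform]
  have hε : ‖frickeEigenvalue f‖ ≤ 1 := by
    rcases IsNewform0.frickeEigenvalue_eq_one_or_eq_neg_one_holds hf with h | h <;> simp [h]
  have hD1 := norm_dampedTwist_le_of_deligne hD hf hy
  have hD2 := norm_dampedTwist_le_of_deligne hD hf one_pos
  have hπ3 : (3 : ℝ) < π := Real.pi_gt_three
  have hb1 : (π * (1 / (N : ℝ)))⁻¹ * ((π * (1 / (N : ℝ)))⁻¹ + 1) ≤ (N : ℝ) ^ 2 := by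
    have e : (π * (1 / (N : ℝ)))⁻¹ = N / π := by field_simp
    rw [e]
    have h1 : (N : ℝ) / π ≤ N / 3 :=
      div_le_div_of_nonneg_left hN0.le (by norm_num) hπ3.le
    have h0 : 0 ≤ (N : ℝ) / π := by positivity
    calc (N : ℝ) / π * ((N : ℝ) / π + 1) ≤ (N / 3) * (N / 3 + 1) :=
          mul_le_mul h1 (by linarith) (by positivity) (by positivity)
      _ ≤ (N : ℝ) ^ 2 := by nlinarith
  have hb2 : (π * (1 : ℝ))⁻¹ * ((π * (1 : ℝ))⁻¹ + 1) ≤ 1 := by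
    rw [mul_one]
    have h1 : π⁻¹ ≤ 1 / 3 := by rw [inv_eq_one_div]; exact div_le_div_of_nonneg_left zero_le_one (by norm_num) hπ3.le
    have h0 : 0 ≤ π⁻¹ := by positivity
    nlinarith
  calc ‖dampedTwist f (fun _ ↦ 1) (1 / (N : ℝ)) - frickeEigenvalue f * dampedTwist f (fun _ ↦ 1) 1‖
      ≤ ‖dampedTwist f (fun _ ↦ 1) (1 / (N : ℝ))‖ + ‖frickeEigenvalue f * dampedTwist f (fun _ ↦ 1) 1‖ :=
        norm_sub_le _ _
    _ ≤ (N : ℝ) ^ 2 + 1 * 1 := by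
        rw [norm_mul]
        exact add_le_add (hD1.trans hb1) (mul_le_mul hε (hD2.trans hb2) (norm_nonneg _) zero_le_one)
    _ ≤ 2 * (N : ℝ) ^ 2 := by nlinarith

/-- **Harmonic averages are bounded by the total harmonic mass**: if `‖α f‖ ≤ A` on the newforms,
then `‖Σ^h_f α_f‖ ≤ A · ‖Σ^h_f 1‖` (the weights `ω_f` are non-negative reals).
[cite: IwaniecKowalski2004, (14.60)] -/
theorem norm_harmonicSum_le_of_forall_le {α : CuspForm (Gamma0 N) 2 → ℂ} {A : ℝ}
    (h : ∀ f ∈ newforms0 N 2, ‖α f‖ ≤ A) :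
    ‖GL2Family.harmonicSum N 2 α‖ ≤ A * ‖GL2Family.harmonicSum N 2 (fun _ ↦ (1 : ℂ))‖ := by
  have hfin := finite_newforms0_holds N 2
  unfold GL2Family.harmonicSum
  rw [finsum_mem_eq_finite_toFinset_sum _ hfin, finsum_mem_eq_finite_toFinset_sum _ hfin]
  have hw : ∀ f : CuspForm (Gamma0 N) 2, 0 ≤ GL2Family.harmonicWeight f := fun f ↦ by
    rw [KowalskiMichel2000.harmonicWeight_eq]; exact IwaniecSarnak.harmonicWeight_nonneg le_rfl f
  have hsum1 : ∑ f ∈ hfin.toFinset, (GL2Family.harmonicWeight f : ℂ) * 1 =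
      ((∑ f ∈ hfin.toFinset, GL2Family.harmonicWeight f : ℝ) : ℂ) := by
    push_cast; simp
  rw [hsum1, Complex.norm_real, Real.norm_of_nonneg (Finset.sum_nonneg fun f _ ↦ hw f),
    Finset.mul_sum]
  refine (norm_sum_le _ _).trans (Finset.sum_le_sum fun f hf ↦ ?_)
  rw [norm_mul, Complex.norm_real, Real.norm_of_nonneg (hw f), mul_comm]
  exact mul_le_mul_of_nonneg_right (h f (hfin.mem_toFinset.mp hf)) (hw f)

/-- **The total harmonic mass at prime level is bounded**, given Petersson's formula:
`‖Σ^h_f 1‖ ≤ 1 + C₁` for all primes `N` (`Σ^h 1 = Σ^h λ_f(1)² = 1 − J_N(1,1)` and (23)).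
[cite: KowalskiMichel2000, §2.4.2 p. 312 (Petersson's formula and (23))] -/
theorem norm_harmonicSum_one_le_of_petersson
    (hP : KowalskiMichel2000.kowalskiMichel2000_peterssonFormula) :
    ∃ K : ℝ, ∀ (N : ℕ) [NeZero N], N.Prime →
      ‖GL2Family.harmonicSum N 2 (fun _ ↦ (1 : ℂ))‖ ≤ K := by
  obtain ⟨C₁, hC₁⟩ := KowalskiMichel2000.norm_petJ_le (ε := 1) one_pos
  refine ⟨1 + |C₁|, fun N _ hN ↦ ?_⟩
  have hpet : KowalskiMichel2000.pet N 1 1 = GL2Family.harmonicSum N 2 (fun _ ↦ (1 : ℂ)) := by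
    unfold KowalskiMichel2000.pet GL2Family.harmonicSum
    refine finsum_mem_congr rfl fun f hf ↦ ?_
    have hf' : IsNewform0 f := hf
    beta_reduce
    rw [GL2Family.heckeLambda_one_of_isNormalized hf'.2.2, mul_one]
  rw [← hpet, (hP N hN 1 1 le_rfl le_rfl).2, if_pos rfl]
  have hJ := hC₁ N hN 1 1 le_rfl le_rfl (KowalskiMichel2000.not_dvd_and_dvd_one hN 1)
  have hN1 : (1 : ℝ) ≤ N := by exact_mod_cast hN.one_lt.le
  have hJ' : ‖KowalskiMichel2000.petJ N 1 1‖ ≤ |C₁| := by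
    refine hJ.trans ?_
    rw [Nat.cast_one, mul_one, Real.one_rpow, mul_one]
    calc C₁ * (N : ℝ) ^ (-(3 / 2 : ℝ)) ≤ |C₁| * (N : ℝ) ^ (-(3 / 2 : ℝ)) :=
          mul_le_mul_of_nonneg_right (le_abs_self _) (Real.rpow_nonneg (by linarith) _)
      _ ≤ |C₁| * 1 := mul_le_mul_of_nonneg_left
          (Real.rpow_le_one_of_one_le_of_nonpos hN1 (by norm_num)) (abs_nonneg _)
      _ = |C₁| := mul_one _
  calc ‖(1 : ℂ) - KowalskiMichel2000.petJ N 1 1‖ ≤ ‖(1 : ℂ)‖ + ‖KowalskiMichel2000.petJ N 1 1‖ :=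
        norm_sub_le _ _
    _ ≤ 1 + |C₁| := by rw [norm_one]; linarith

/-! ### The large-shift regime and the named fact -/

/-- **Stub S6 of the I2 skeleton, from Deligne's bound and Petersson's formula** (Bettin 2017,
p. 5: «we assume m ≪ N^{100}, otherwise the result is trivial»): with `B = 12`, for every `ε > 0`
there are `C, N₀` with `‖Σ^h_f λ_f(m) L(½,f) − m^{-1/2}‖ ≤ C m^{1/2} N^{-1+ε}` for all primes `N ≥ N₀`
and all `m ≥ N^{12}`. [cite: Bettin2017, §2 (p. 5, first paragraph)] [cite: Deligne1974, Thm. 8.2] -/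
theorem largeShift_of_deligne_of_petersson (hD : Deligne1974_heckeT_eigenvalue_norm_le)
    (hP : KowalskiMichel2000.kowalskiMichel2000_peterssonFormula) :
    ∃ B : ℕ, ∀ ε : ℝ, 0 < ε → ∃ C : ℝ, ∃ N₀ : ℕ, ∀ (N : ℕ) [NeZero N], N.Prime → N₀ ≤ N →
      ∀ m : ℕ, (N : ℝ) ^ B ≤ m →
        ‖GL2Family.harmonicSum N 2
              (fun f ↦ GL2Family.heckeLambda f m * IwaniecSarnak.centralValue f) -
            (((m : ℝ) ^ (-(1 / 2 : ℝ)) : ℝ) : ℂ)‖ ≤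
          C * (m : ℝ) ^ (1 / 2 : ℝ) * (N : ℝ) ^ (-1 + ε) := by
  obtain ⟨K, hK⟩ := norm_harmonicSum_one_le_of_petersson hP
  obtain ⟨Cd, hCd1, hCd⟩ :=
    Literature.NumberTheory.Sieve.exists_card_divisors_le_mul_rpow' (by norm_num : (0 : ℝ) < 1 / 4)
  refine ⟨12, fun ε hε ↦ ⟨2 * |K| * Cd + 1, 2, fun N _ hN hN₀ m hm ↦ ?_⟩⟩
  have hN2 : (2 : ℝ) ≤ N := by exact_mod_cast hN₀
  have hN0 : (0 : ℝ) < N := by linarith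
  have hN1 : (1 : ℝ) ≤ N := by linarith
  have hK0 : 0 ≤ |K| := abs_nonneg K
  have hKN : ‖GL2Family.harmonicSum N 2 (fun _ ↦ (1 : ℂ))‖ ≤ |K| := (hK N hN).trans (le_abs_self K)
  -- `m ≥ N^12 ≥ 1`
  have hm1 : (1 : ℝ) ≤ m := le_trans (one_le_pow₀ hN1) hm
  have hm0 : (0 : ℝ) < m := by linarith
  have hmnat : 1 ≤ m := by exact_mod_cast hm1
  -- the moment: `‖Σ^h λ_f(m) L(½,f)‖ ≤ (d(m) · 2N²) · |K|`
  have hterm : ∀ f ∈ newforms0 N 2,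
      ‖GL2Family.heckeLambda f m * IwaniecSarnak.centralValue f‖ ≤
        (m.divisors.card : ℝ) * (2 * (N : ℝ) ^ 2) := by
    intro f hf
    rw [norm_mul]
    exact mul_le_mul (GL2Family.norm_heckeLambda_le_card_divisors_of_deligne hD hf m)
      (norm_centralValue_le_of_deligne hD hN₀ hf) (norm_nonneg _) (Nat.cast_nonneg _)
  have hM := norm_harmonicSum_le_of_forall_le hterm
  have hd : (m.divisors.card : ℝ) ≤ Cd * (m : ℝ) ^ (1 / 4 : ℝ) := hCd m
  -- `m^{1/4} N² ≤ m^{1/2} N^{-1}` since `N^3 ≤ m^{1/4}`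
  have hquarter : (N : ℝ) ^ 3 ≤ (m : ℝ) ^ (1 / 4 : ℝ) := by
    have h1 : ((N : ℝ) ^ 12) ^ (1 / 4 : ℝ) ≤ (m : ℝ) ^ (1 / 4 : ℝ) :=
      Real.rpow_le_rpow (by positivity) hm (by norm_num)
    rw [show ((N : ℝ) ^ 12) = (N : ℝ) ^ ((12 : ℕ) : ℝ) by rw [Real.rpow_natCast],
      ← Real.rpow_mul hN0.le] at h1
    norm_num at h1
    rw [show (N : ℝ) ^ 3 = (N : ℝ) ^ ((3 : ℕ) : ℝ) by rw [Real.rpow_natCast]]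
    norm_num
    exact h1
  have hhalf : (m : ℝ) ^ (1 / 2 : ℝ) = (m : ℝ) ^ (1 / 4 : ℝ) * (m : ℝ) ^ (1 / 4 : ℝ) := by
    rw [← Real.rpow_add hm0]; norm_num
  have hNm1 : (N : ℝ) ^ (-1 + ε) ≥ (N : ℝ)⁻¹ := by
    rw [ge_iff_le, ← Real.rpow_neg_one]
    exact Real.rpow_le_rpow_of_exponent_le hN1 (by linarith)
  have hX0 : 0 ≤ (m : ℝ) ^ (1 / 2 : ℝ) * (N : ℝ) ^ (-1 + ε) :=
    mul_nonneg (Real.rpow_nonneg hm0.le _) (Real.rpow_nonneg hN0.le _)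
  -- main bound for the moment
  have hmain : ‖GL2Family.harmonicSum N 2
      (fun f ↦ GL2Family.heckeLambda f m * IwaniecSarnak.centralValue f)‖ ≤
      2 * |K| * Cd * ((m : ℝ) ^ (1 / 2 : ℝ) * (N : ℝ) ^ (-1 + ε)) := by
    have h1 : ‖GL2Family.harmonicSum N 2
        (fun f ↦ GL2Family.heckeLambda f m * IwaniecSarnak.centralValue f)‖ ≤
        Cd * (m : ℝ) ^ (1 / 4 : ℝ) * (2 * (N : ℝ) ^ 2) * |K| := by
      refine hM.trans ?_
      exact mul_le_mul (mul_le_mul_of_nonneg_right hd (by positivity)) hKN (norm_nonneg _)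
        (by positivity)
    refine h1.trans ?_
    -- `Cd m^{1/4} 2N² |K| ≤ 2|K|Cd m^{1/2} N^{-1} ≤ 2|K|Cd m^{1/2}N^{-1+ε}`
    have h2 : (m : ℝ) ^ (1 / 4 : ℝ) * (N : ℝ) ^ 2 ≤ (m : ℝ) ^ (1 / 2 : ℝ) * (N : ℝ)⁻¹ := by
      rw [hhalf]
      have : (N : ℝ) ^ 2 = (N : ℝ) ^ 3 * (N : ℝ)⁻¹ := by field_simp
      rw [this, mul_assoc]
      refine mul_le_mul_of_nonneg_left ?_ (Real.rpow_nonneg hm0.le _)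
      exact mul_le_mul_of_nonneg_right hquarter (inv_nonneg.mpr hN0.le)
    have h3 : (m : ℝ) ^ (1 / 2 : ℝ) * (N : ℝ)⁻¹ ≤ (m : ℝ) ^ (1 / 2 : ℝ) * (N : ℝ) ^ (-1 + ε) :=
      mul_le_mul_of_nonneg_left hNm1 (Real.rpow_nonneg hm0.le _)
    calc Cd * (m : ℝ) ^ (1 / 4 : ℝ) * (2 * (N : ℝ) ^ 2) * |K|
        = 2 * |K| * Cd * ((m : ℝ) ^ (1 / 4 : ℝ) * (N : ℝ) ^ 2) := by ring
      _ ≤ 2 * |K| * Cd * ((m : ℝ) ^ (1 / 2 : ℝ) * (N : ℝ) ^ (-1 + ε)) :=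
          mul_le_mul_of_nonneg_left (h2.trans h3) (by positivity)
  -- the diagonal constant `m^{-1/2} ≤ m^{1/2} N^{-1+ε}`
  have hdiag : ‖((((m : ℝ) ^ (-(1 / 2 : ℝ)) : ℝ) : ℂ))‖ ≤ (m : ℝ) ^ (1 / 2 : ℝ) * (N : ℝ) ^ (-1 + ε) := by
    rw [Complex.norm_real, Real.norm_of_nonneg (Real.rpow_nonneg hm0.le _)]
    have hNm : (N : ℝ) ≤ m := le_trans (by nlinarith [pow_le_pow_right₀ hN1 (show 1 ≤ 12 by norm_num)]) hm
    -- `m^{-1/2} = m^{1/2} · m⁻¹ ≤ m^{1/2} N⁻¹ ≤ m^{1/2} N^{-1+ε}`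
    have e1 : (m : ℝ) ^ (-(1 / 2 : ℝ)) = (m : ℝ) ^ (1 / 2 : ℝ) * (m : ℝ)⁻¹ := by
      rw [← Real.rpow_neg_one, ← Real.rpow_add hm0]; norm_num
    rw [e1]
    refine mul_le_mul_of_nonneg_left ?_ (Real.rpow_nonneg hm0.le _)
    exact le_trans (inv_anti₀ hN0 hNm) hNm1
  calc ‖GL2Family.harmonicSum N 2
          (fun f ↦ GL2Family.heckeLambda f m * IwaniecSarnak.centralValue f) -
        (((m : ℝ) ^ (-(1 / 2 : ℝ)) : ℝ) : ℂ)‖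
      ≤ ‖GL2Family.harmonicSum N 2
          (fun f ↦ GL2Family.heckeLambda f m * IwaniecSarnak.centralValue f)‖ +
          ‖(((m : ℝ) ^ (-(1 / 2 : ℝ)) : ℝ) : ℂ)‖ := norm_sub_le _ _
    _ ≤ 2 * |K| * Cd * ((m : ℝ) ^ (1 / 2 : ℝ) * (N : ℝ) ^ (-1 + ε)) +
          (m : ℝ) ^ (1 / 2 : ℝ) * (N : ℝ) ^ (-1 + ε) := add_le_add hmain hdiag
    _ = (2 * |K| * Cd + 1) * (m : ℝ) ^ (1 / 2 : ℝ) * (N : ℝ) ^ (-1 + ε) := by ring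

/-- **Bettin 2017, Thm. 1.1 at prime level (the named fact `bettin2017_theorem11_primeLevel`) from
Petersson's formula and Deligne's bound.** Everything else — the exact two-sided central-value
formula, Petersson inside the average, the off-diagonal by partial summation and Weil's bound, the
dual piece, and the large-shift regime — is a kernel theorem of the tree.
[cite: Bettin2017, Thm. 1.1 (case ν = 1, k = 2, χ = 1, α = 0)] [cite: Deligne1974, Thm. 8.2]
[cite: KowalskiMichel2000, §2.4.2 p. 312 (Petersson's formula)] -/
theorem bettin2017_theorem11_primeLevel_of_petersson_of_deligne
    (hP : KowalskiMichel2000.kowalskiMichel2000_peterssonFormula)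
    (hD : Deligne1974_heckeT_eigenvalue_norm_le) : bettin2017_theorem11_primeLevel :=
  bettin2017_theorem11_primeLevel_of_petersson_of_largeShift hP
    (largeShift_of_deligne_of_petersson hD hP)

end Literature.NumberTheory.LFunctions.Bettin2017

end
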